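import Summits.AtomisticToContinuum.Crystallization.Theorems.FluxTubeKeplerFluxCellKeplerSingleScale
import Summits.AtomisticToContinuum.Crystallization.Theorems.ChessboardParticlePlanesPeriodicWindowsIffCrystallization

/-!
# F4 on-path lemma for the forward rung `PosTolRung`: `Crystallization → PosTolRung`

Every member `TolRung η₀` of the tolerance ladder — in particular the deciding rung `PosTolRung` — is a
consequence of the sub-problem `Crystallization`, through the landed hull-criterion converse
`ChessboardParticlePlanesPeriodicWindowsIffCrystallization.periodicWindows_of_crystallization`
(crystallization ⇒ periodic windows along every ground-state sequence).  Together with antitonicity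
(`tolRung_anti`) this is the dial monotonicity of the family.  Self-contained copy (sub-namespace `OnPath`)
of the five definitions of `Lines/PosTolRung.lean`; the canonical `ToleranceLadder.PosTolRung_of_Crystallization`
lives there with the same text.  No `sorry`.
-/

noncomputable section

namespace Summit.AtomisticToContinuum.Crystallization.Cruxes.FluxCellKepler.ToleranceLadder.OnPath

open Filter Topology
open Literature.MathematicalPhysics.StatisticalMechanics
open Summit.AtomisticToContinuum.Crystallization.Theorems.FluxCellKeplerSingleScale (LayeredGood)

local notation "E3" => EuclideanSpace ℝ (Fin 3)

/-- FLOOR(P₀) (verbatim copy of `ToleranceLadder.Floor` in `Lines/PosTolRung.lean`). -/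
def Floor (P₀ : PeriodicConfiguration 3) : Prop :=
  ∀ (N : ℕ) (x : Fin N → E3), IsGroundState lennardJones x →
    (N : ℝ) * P₀.energyPerParticle lennardJones ≤ interactionEnergy lennardJones x

/-- BUDGET(P₀) at tolerances `η ≥ η₀` (verbatim copy of `ToleranceLadder.Budget`). -/
def Budget (η₀ : ℝ) (P₀ : PeriodicConfiguration 3) : Prop :=
  ∀ R η : ℝ, 0 < R → η₀ ≤ η → 0 < η → ∃ c : ℝ, 0 < c ∧
    ∀ (N : ℕ) (x : Fin N → E3), IsGroundState lennardJones x →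
      c * (Nat.card {i : Fin N // ¬ LayeredGood R η x i} : ℝ) ≤
        interactionEnergy lennardJones x - (N : ℝ) * P₀.energyPerParticle lennardJones

/-- Periodic windows along `x` (verbatim copy of `ToleranceLadder.HasPeriodicWindows`). -/
def HasPeriodicWindows (x : (N : ℕ) → (Fin N → E3)) : Prop :=
  ∃ P : PeriodicConfiguration 3, ∀ R ε : ℝ, 0 < ε → ∃ᶠ N in atTop, ∃ t : E3,
    (∀ s ∈ P.points, ‖s‖ ≤ R → ∃ i : Fin N, dist (x N i + t) s ≤ ε) ∧
    (∀ i : Fin N, ‖x N i + t‖ ≤ R → ∃ s ∈ P.points, dist (x N i + t) s ≤ ε)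

/-- The graded family (verbatim copy of `ToleranceLadder.TolRung`). -/
def TolRung (η₀ : ℝ) : Prop :=
  ∀ P₀ : PeriodicConfiguration 3, Floor P₀ → Budget η₀ P₀ →
    ∀ x : (N : ℕ) → (Fin N → E3), (∀ N, IsGroundState lennardJones (x N)) → HasPeriodicWindows x

/-- The deciding rung (verbatim copy of `ToleranceLadder.PosTolRung`). -/
def PosTolRung : Prop := ∃ η₀ : ℝ, 0 < η₀ ∧ TolRung η₀

/-- Dial monotonicity: `TolRung` is antitone in the tolerance. -/
theorem tolRung_anti {η₀ η₁ : ℝ} (h : η₀ ≤ η₁) : TolRung η₁ → TolRung η₀ :=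
  fun H P₀ hF hB x hx => H P₀ hF (fun R η hR hη₁ hη => hB R η hR (h.trans hη₁) hη) x hx

/-- ON-PATH: the sub-problem implies every member of the family. -/
theorem tolRung_of_crystallization (η₀ : ℝ) (h : _root_.Crystallization) : TolRung η₀ :=
  fun _ _ _ x hx =>
    Theorems.ChessboardParticlePlanesPeriodicWindowsIffCrystallization.periodicWindows_of_crystallization h x hx

/-- **F4 — `Crystallization → PosTolRung`.** -/
@[aesop safe apply]
theorem PosTolRung_of_Crystallization (h : _root_.Crystallization) : PosTolRung :=
  ⟨1, one_pos, tolRung_of_crystallization 1 h⟩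

end Summit.AtomisticToContinuum.Crystallization.Cruxes.FluxCellKepler.ToleranceLadder.OnPath

end
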